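import Mathlib.Data.Rat.Defs
import Mathlib.Tactic.Linarith
import Mathlib.Tactic.LinearCombination
import Mathlib.Tactic.NormNum
import Mathlib.Tactic.Ring
import Mathlib.Tactic.Positivity
import HarnessLib

/-!
# The (0,1) cell of the ι-window, XXIII: the product ground `B₁ × B₂`, X — THE DOUBLE BRILL–NOETHER RESIDUAL IS EMPTY
# (THEOREM DBN of report [XXIII]): arithmetic shadows

Family `hodge`, b2b cell `hweil` (helper of item stmt-HodgeConjecture-2524). Companion (`pg10_*`) of
`WeilTypeLadderH2ProductGround{Two,…,Nine,NineB}.lean` (prover 1, generations 27–34). Report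
`run/shared/lean/b2b/hodge-weil/b2b-hweil-pv1-g35/H2-ZERO-ONE-23.md` ([XXIII]). HONEST FRAMING: census results inside the ladder's H2 test
((0,1) cell) on the SPECIAL fourfold `X₀ = B₁ × B₂`; emptiness / non-isolation of a family there is a census line and nothing more. No case of
the Hodge conjecture is proved; nothing here is a rung; no statement of [Markman 2025] / [Perry 2026] / [EdGFS 2025] is used. Every head is the
elementary arithmetic SHADOW of a named step of the report; the sheaf theory (Fourier–Mukai equivalence of the neutral semi-homogeneous class,
[Yanagida–Yoshioka, Crelle 684 (2013), Prop. 2.14 / Facts 2.6, 2.10, 2.12 / Lemma 2.7], Parseval, Serre duality, purity) lives in the report.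

Conventions as in the companions: classes `(r, c, s)` on a principally polarised abelian surface with `NS = ℤθ` (`s = χ`), Mukai pairing
`⟨(r,c,s),(r',c',s')⟩ = 2cc' − rs' − r's = −χ`, slope `μ = 2c/r`; linear forms `λ = (β, δ) ↔ βX + δY`, `[λ²] = (β², βδ, δ²)`,
`[2λλ'] = (2ββ', βδ'+β'δ, 2δδ')`. THE SETTING (*) of [XXIII] §3: a frame `(λ_j, λ_n)` ('jump', 'neutral') with `β_j, β_n > 0` and
`det(λ_j, λ_n) = β_jδ_n − β_nδ_j = −1`; `u_j = [λ_j²]`, `u_n = [λ_n²]`, `n = [2λ_jλ_n]`, and the balanced class `w = 6u_n + 2n` — this is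
`(𝔉*(ρ)` of a type-II bottom, `w = w₂)` and `(𝔉*(ρ)^∨` of a type-I bottom, `w = w₁^∨)` at once ([XXI] THEOREM UF).

* `pg10_setting` — the pairings of (*): `⟨u_n,u_j⟩ = −1`, `⟨u_n,w⟩ = 0` (χ-neutral), `⟨u_j,w⟩ = −6` (χ(Q,M) = 6), `⟨w,w⟩ = 8`, `⟨n,n⟩ = 2`,
  `⟨u_n,n⟩ = ⟨u_j,n⟩ = 0`, `rk w = 2β_n(3β_n + 2β_j)`, and the slope identity `c₁(w)·β_n = δ_n·rk(w) + 2β_n` (i.e. `μ(w) = 2δ_n/β_n + 4/rk w`).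
* `pg10_window` — the window `μ(u_n) < μ(w) < μ(u_j)` of (*) (cleared denominators).
* `pg10_imageY` — the cohomological Fourier–Mukai transform `Ξ^H` on the Y-side ([XXIII] 3.2 (iv)): with `Ξ^H(u_n) = (0,0,1)`, `Ξ^H(u_j) = (1,0,0)`
  the isometry forces `Ξ^H(n) = (0,∓1,0)` and `Ξ^H(w) = (0,∓2,6)`; only the sign `−` gives the transform `Q̃` (class `−Ξ^H(w) = (0, 2, −6)`) an
  effective first Chern class; the Y-side pairings reproduce `−1, 0, −6, 8, 2`; `c₁(Q̃)² = 8 = 2·2²` (class `2Ĥ` on the principally polarised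
  partner, `Ĥ² = 2`), `χ(Q̃) = −6`, `p_a(2Ĥ) = 5`, and a rank-one sheaf of Euler characteristic `−6` on an integral curve of arithmetic genus `5`
  has degree `−2 < 0` ([XXIII] 4.2 (α)).
* `pg10_deg_restriction` — [XXIII] 3.2 (vi): the degree of the kernel bundle `𝓕_x` on a theta translate `C ⊂ Y` is `−2β_jβ_n` (from
  `χ(C, 𝓕_x|_C ⊗ K) = rk Ψ^H(0,1,k−1) = (k−1)β_n² − 2β_jβ_n` and Riemann–Roch on the genus-2 curve).
* `pg10_sub_class` — [XXIII] 4.3 (β), the destabilising subsheaf: `S = Ψ¹(K_b)` has class `n − (e−1)u_n`; `rk S = 2β_jβ_n − (e−1)β_n²`,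
  `c₁(S)·β_n = δ_n·rk S + β_n`, the KEY IDENTITY `c₁(S)·rk(w) − c₁(w)·rk(S) = 2β_n²(e+2) = rk(w) − 2 rk(S)`; hence for `e ≥ −1`:
  `rk S > 0 ⟹ μ(S) > μ(w)` and `rk S < rk w`.
* `pg10_curve_cases` — the integer bookkeeping of LEMMA CS ([XXIII] §4): two theta translates (`d_a + d_b = ℓ − 4`, `ℓ ≤ Ĥ² = 2`,
  `e + d_a = −4`, the three ranges of `d_a`), the double theta divisor of type (A) and (B), and the nilpotent degrees.
* `pg10_minimal_b1` — [XXIII] §6 (R-JD-B1 closed): type-(B) sheaves on `2Θ_κ″` of class `(0, 2θ, 2)` with `H¹(Q(Θ_{κ₁})) ≠ 0` carry a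
  non-zero nilpotent endomorphism (`2d + ℓ = 6`, jump ⟹ `d ≤ 0` ⟹ `deg 𝓗om(Q′, G₁) = 4 − 2d ≥ 4`).
* `pg10_example_12` — the instance (1,2): frame `((1,1),(1,0))`, `det = −1`, `u_j = (1,1,1) = 𝒪(Θ′)`, `u_n = (1,0,0) = P_z`, `n = (2,1,0)`,
  `w₂ = (10,2,0)`; `Φ(w₂) = (0,−2,10)`, `Q̂` of class `(0,2,−10)`, `Q̂(Θ̂) ` of class `(0,2,−6)`; `hom(Q₂, 𝒪(Θ′)) = 6 + h⁰ = 6 < 8`.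
* `pg10_counts` — the box after THEOREM DBN: `1 + 1 + 26 + 415 = 443` readings of height `≤ 40` ([XXII] 7.1) become `VOID 417 + EMPTY 26`;
  types `132 + 311`.
-/

-- mandated namespace `Summit.HodgeConjecture.HodgeConjecture.…` (Problem = Summit) trips `linter.dupNamespace`; the lakefile disables it
-- tree-wide (weak option), restated here so stand-alone elaboration is warning-free too.
set_option linter.dupNamespace false

namespace Summit.HodgeConjecture.HodgeConjecture.WeilTypeLadder

section ProductGroundTen

/-- **The setting (*) ([XXIII] §3.0).** For a frame `(λ_j, λ_n) = ((β_j,δ_j),(β_n,δ_n))` with `β_jδ_n − β_nδ_j = −1`, the classes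
`u_j = (β_j², β_jδ_j, δ_j²)`, `u_n = (β_n², β_nδ_n, δ_n²)`, `n = (2β_jβ_n, β_jδ_n + β_nδ_j, 2δ_jδ_n)` and `w = 6u_n + 2n` satisfy, for the
Mukai pairing `⟨(r,c,s),(r',c',s')⟩ = 2cc' − rs' − r's`: `⟨u_n,u_j⟩ = −1`, `⟨n,n⟩ = 2`, `⟨u_n,n⟩ = 0`, `⟨u_j,n⟩ = 0`, `⟨u_n,u_n⟩ = 0`,
`⟨u_n,w⟩ = 0` (the neutral piece is χ-neutral against `w`), `⟨u_j,w⟩ = −6` (`χ(Q,M) = 6`), `⟨w,w⟩ = 8` (norm 4), `rk w = 2β_n(3β_n+2β_j)`,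
and `c₁(w)·β_n = δ_n·rk(w) + 2β_n`. [shadow: `ring` / `linear_combination`] -/
theorem pg10_setting (bj dj bn dn : ℤ) (h : bj * dn - bn * dj = -1) :
    (2 * (bn * dn) * (bj * dj) - bn ^ 2 * dj ^ 2 - bj ^ 2 * dn ^ 2 = -1) ∧
    (2 * (bj * dn + bn * dj) * (bj * dn + bn * dj) - (2 * bj * bn) * (2 * dj * dn) - (2 * bj * bn) * (2 * dj * dn) = 2) ∧
    (2 * (bn * dn) * (bj * dn + bn * dj) - bn ^ 2 * (2 * dj * dn) - (2 * bj * bn) * dn ^ 2 = 0) ∧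
    (2 * (bj * dj) * (bj * dn + bn * dj) - bj ^ 2 * (2 * dj * dn) - (2 * bj * bn) * dj ^ 2 = 0) ∧
    (2 * (bn * dn) * (bn * dn) - bn ^ 2 * dn ^ 2 - bn ^ 2 * dn ^ 2 = 0) ∧
    (2 * (bn * dn) * (6 * (bn * dn) + 2 * (bj * dn + bn * dj))
        - bn ^ 2 * (6 * dn ^ 2 + 2 * (2 * dj * dn)) - (6 * bn ^ 2 + 2 * (2 * bj * bn)) * dn ^ 2 = 0) ∧
    (2 * (bj * dj) * (6 * (bn * dn) + 2 * (bj * dn + bn * dj))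
        - bj ^ 2 * (6 * dn ^ 2 + 2 * (2 * dj * dn)) - (6 * bn ^ 2 + 2 * (2 * bj * bn)) * dj ^ 2 = -6) ∧
    (2 * (6 * (bn * dn) + 2 * (bj * dn + bn * dj)) * (6 * (bn * dn) + 2 * (bj * dn + bn * dj))
        - 2 * ((6 * bn ^ 2 + 2 * (2 * bj * bn)) * (6 * dn ^ 2 + 2 * (2 * dj * dn))) = 8) ∧
    (6 * bn ^ 2 + 2 * (2 * bj * bn) = 2 * bn * (3 * bn + 2 * bj)) ∧
    ((6 * (bn * dn) + 2 * (bj * dn + bn * dj)) * bn = dn * (6 * bn ^ 2 + 2 * (2 * bj * bn)) + 2 * bn) := by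
  refine ⟨?_, ?_, by ring, by ring, by ring, by ring, ?_, ?_, by ring, ?_⟩
  · linear_combination (1 - (bj * dn - bn * dj)) * h
  · linear_combination (2 * ((bj * dn - bn * dj) - 1)) * h
  · linear_combination (6 * (1 - (bj * dn - bn * dj))) * h
  · linear_combination (8 * ((bj * dn - bn * dj) - 1)) * h
  · linear_combination (-(2 * bn)) * h

/-- **The slope window of (*) ([XXIII] §3.0; = [XXI] UF (iv) in this frame).** With `β_j, β_n > 0` and `det = −1`:
`μ(u_n) = 2δ_n/β_n < μ(w) = 2c₁(w)/rk(w) < μ(u_j) = 2δ_j/β_j`, as the cleared-denominator inequalities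
`δ_n·rk(w) < c₁(w)·β_n` and `c₁(w)·β_j < δ_j·rk(w)` (indeed `δ_j·rk(w) − c₁(w)·β_j = 6β_n + 2β_j`); both ranks are positive. [shadow] -/
theorem pg10_window (bj dj bn dn : ℤ) (h : bj * dn - bn * dj = -1) (hbj : 0 < bj) (hbn : 0 < bn) :
    0 < 6 * bn ^ 2 + 2 * (2 * bj * bn) ∧
    dn * (6 * bn ^ 2 + 2 * (2 * bj * bn)) < (6 * (bn * dn) + 2 * (bj * dn + bn * dj)) * bn ∧
    dj * (6 * bn ^ 2 + 2 * (2 * bj * bn)) - (6 * (bn * dn) + 2 * (bj * dn + bn * dj)) * bj = 6 * bn + 2 * bj ∧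
    (6 * (bn * dn) + 2 * (bj * dn + bn * dj)) * bj < dj * (6 * bn ^ 2 + 2 * (2 * bj * bn)) := by
  have e1 : (6 * (bn * dn) + 2 * (bj * dn + bn * dj)) * bn = dn * (6 * bn ^ 2 + 2 * (2 * bj * bn)) + 2 * bn := by
    linear_combination (-(2 * bn)) * h
  have e2 : dj * (6 * bn ^ 2 + 2 * (2 * bj * bn)) - (6 * (bn * dn) + 2 * (bj * dn + bn * dj)) * bj = 6 * bn + 2 * bj := by
    linear_combination (-(6 * bn + 2 * bj)) * h
  refine ⟨by positivity, by linarith, e2, by linarith⟩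

/-- **The cohomological transform on the Y-side ([XXIII] 3.2 (iv)–(v)).** On the Fourier–Mukai partner `Y` (principally polarised,
`NS(Y) = ℤĤ`, `Ĥ² = 2`; classes `(r, cĤ, s)` with the same pairing formula) put `û_n := (0,0,1)` (skyscraper), `û_j := (1,0,0)` (`𝒪_Y`),
`n̂ := (0,−1,0)`, `ŵ := 6û_n + 2n̂ = (0,−2,6)`. Then the pairings are those of (*) (`−1, 2, 0, 0, 0, −6, 8`) — so `Ξ^H: u_n ↦ û_n, u_j ↦ û_j,
n ↦ n̂` is the isometry —; the other solution `n ↦ (0,1,0)` of `⟨n̂,n̂⟩ = 2`, `⟨n̂,û⟩ = 0` gives `ŵ' = (0,2,6)` and `−ŵ'` has NEGATIVE `c₁`, so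
it is excluded by the effectivity of `c₁(Q̃)`, `v(Q̃) = −Ξ^H(w) = (0,2,−6)`: `c₁(Q̃) = 2Ĥ` (`(2Ĥ)² = 8`), `χ(Q̃) = −6`; the arithmetic genus of a
curve of class `2Ĥ` is `1 + 8/2 = 5` and a rank-one torsion-free sheaf with `χ = −6` on such an integral curve has degree `−6 − (1−5) = −2 < 0`,
hence no sections ([XXIII] 4.2 (α)). A line bundle of degree `k` on a theta translate has class `(0,1,k−1) = −n̂ + (k−1)û_n`, the vector whose
`Ψ^H`-image is `−n + (k−1)u_n`. [shadow: `decide`/`norm_num`] -/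
theorem pg10_imageY :
    let P : ℤ × ℤ × ℤ → ℤ × ℤ × ℤ → ℤ := fun u v => 2 * u.2.1 * v.2.1 - u.1 * v.2.2 - v.1 * u.2.2
    P (0,0,1) (1,0,0) = -1 ∧ P (0,-1,0) (0,-1,0) = 2 ∧ P (0,0,1) (0,-1,0) = 0 ∧ P (1,0,0) (0,-1,0) = 0 ∧ P (0,0,1) (0,0,1) = 0 ∧
    ((6 * 0 + 2 * 0, 6 * 0 + 2 * (-1), 6 * 1 + 2 * 0) = ((0 : ℤ), (-2 : ℤ), (6 : ℤ))) ∧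
    P (0,0,1) (0,-2,6) = 0 ∧ P (1,0,0) (0,-2,6) = -6 ∧ P (0,-2,6) (0,-2,6) = 8 ∧
    (P (0,1,0) (0,1,0) = 2 ∧ P (0,0,1) (0,1,0) = 0 ∧ P (1,0,0) (0,1,0) = 0 ∧ -(6 * 0 + 2 * (1 : ℤ)) < 0) ∧
    (2 * (2 : ℤ) ^ 2 = 8 ∧ (1 : ℤ) + 8 / 2 = 5 ∧ (-6 : ℤ) - (1 - 5) = -2 ∧ (-2 : ℤ) < 0) ∧
    (∀ k : ℤ, ((0 : ℤ), (1 : ℤ), k - 1) = (-(0 : ℤ) + (k - 1) * 0, -(-1) + (k - 1) * 0, -(0 : ℤ) + (k - 1) * 1)) := by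
  refine ⟨by decide, by decide, by decide, by decide, by decide, by decide, by decide, by decide, by decide, by decide, by norm_num, ?_⟩
  intro k; ext <;> simp

/-- **Degree of the kernel bundle on a theta translate ([XXIII] 3.2 (vi)).** If `χ(C, 𝓕_x|_C ⊗ K) = rk Ψ^H(v(K)) = (k−1)β_n² − 2β_jβ_n` for a
line bundle `K` of degree `k` on the genus-2 curve `C`, Riemann–Roch `χ = deg(𝓕_x|_C) + kβ_n² + β_n²(1 − 2)` forces `deg(𝓕_x|_C) = −2β_jβ_n`,
i.e. slope `−2β_j/β_n < 0`. [shadow: `linarith`] -/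
theorem pg10_deg_restriction (bj bn k d : ℤ) (h : (k - 1) * bn ^ 2 - 2 * bj * bn = d + k * bn ^ 2 + bn ^ 2 * (1 - 2)) :
    d = -(2 * bj * bn) := by
  linarith

/-- **The destabilising subsheaf ([XXIII] 4.3 (β)).** In (*) let `S` have class `n − (e−1)u_n` (`= v(Ψ¹(K_b))` for the kernel line bundle `K_b`
of degree `e` on a theta translate): `rk S = 2β_jβ_n − (e−1)β_n²`, `c₁(S) = (β_jδ_n + β_nδ_j) − (e−1)β_nδ_n`, `c₁(S)·β_n = δ_n·rk S + β_n`
(`μ(S) = 2δ_n/β_n + 2/rk S`), and the KEY IDENTITY `c₁(S)·rk(w) − c₁(w)·rk(S) = 2β_n²(e+2) = rk(w) − 2·rk(S)`. Consequently, for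
`β_j, β_n > 0` and `e ≥ −1`: if `rk S > 0` then `μ(S) > μ(w)` (cleared: `c₁(S)·rk w > c₁(w)·rk S`) and `rk S < rk w` — a subsheaf of this class destabilises
the μ-semistable `Q`; `rk S = 0` / `< 0` are excluded in the report (torsion in a locally free sheaf / impossible). [shadow] -/
theorem pg10_sub_class (bj dj bn dn e : ℤ) (h : bj * dn - bn * dj = -1) :
    ((bj * dn + bn * dj) - (e - 1) * (bn * dn)) * bn = dn * (2 * bj * bn - (e - 1) * bn ^ 2) + bn ∧
    ((bj * dn + bn * dj) - (e - 1) * (bn * dn)) * (6 * bn ^ 2 + 2 * (2 * bj * bn))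
      - (6 * (bn * dn) + 2 * (bj * dn + bn * dj)) * (2 * bj * bn - (e - 1) * bn ^ 2) = 2 * bn ^ 2 * (e + 2) ∧
    (6 * bn ^ 2 + 2 * (2 * bj * bn)) - 2 * (2 * bj * bn - (e - 1) * bn ^ 2) = 2 * bn ^ 2 * (e + 2) ∧
    (0 < bj → 0 < bn → -1 ≤ e →
      (0 < 2 * bj * bn - (e - 1) * bn ^ 2 →
        (6 * (bn * dn) + 2 * (bj * dn + bn * dj)) * (2 * bj * bn - (e - 1) * bn ^ 2)
          < ((bj * dn + bn * dj) - (e - 1) * (bn * dn)) * (6 * bn ^ 2 + 2 * (2 * bj * bn))) ∧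
      2 * bj * bn - (e - 1) * bn ^ 2 < 6 * bn ^ 2 + 2 * (2 * bj * bn)) := by
  have k1 : ((bj * dn + bn * dj) - (e - 1) * (bn * dn)) * bn = dn * (2 * bj * bn - (e - 1) * bn ^ 2) + bn := by
    linear_combination (-bn) * h
  have k2 : ((bj * dn + bn * dj) - (e - 1) * (bn * dn)) * (6 * bn ^ 2 + 2 * (2 * bj * bn))
      - (6 * (bn * dn) + 2 * (bj * dn + bn * dj)) * (2 * bj * bn - (e - 1) * bn ^ 2) = 2 * bn ^ 2 * (e + 2) := by
    linear_combination (-(2 * bn ^ 2 * (e + 2))) * h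
  have k3 : (6 * bn ^ 2 + 2 * (2 * bj * bn)) - 2 * (2 * bj * bn - (e - 1) * bn ^ 2) = 2 * bn ^ 2 * (e + 2) := by ring
  refine ⟨k1, k2, k3, ?_⟩
  intro hbj hbn he
  have hb2 : 0 < bn ^ 2 := by positivity
  have he2 : 0 < e + 2 := by linarith
  have hpos : 0 < 2 * bn ^ 2 * (e + 2) := by positivity
  have hw : 0 < 6 * bn ^ 2 + 2 * (2 * bj * bn) := by positivity
  refine ⟨fun _ => by linarith, by nlinarith⟩

/-- **Integer bookkeeping of LEMMA CS ([XXIII] §4).** (β) two theta translates `C_a ∪ C_b` (`C_a·C_b = Ĥ² = 2`): `G ↪ G_a ⊕ G_b` with cokernel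
of length `ℓ ≤ 2`, `χ(G) = (d_a − 1) + (d_b − 1) − ℓ = −6`, so `d_a + d_b = ℓ − 4 ≤ −2` and `min ≤ −1`; the kernel `K_b = ker(G → G_a)` has degree
`e` with `(e − 1) + (d_a − 1) = −6`, i.e. `e = −4 − d_a`; the three ranges: `d_a ≤ −3 ⟺ e ≥ −1` (killed by `pg10_sub_class`), `d_a ∈ {−2,−1} ⟹
e ≤ −2 < 0` (no sections on either piece), and `h⁰ ≥ 2` on `K_b` would need `e ≥ 2 ⟺ d_a ≤ −6`. (γA) `G = i_*E`, `deg E = −4`: a section's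
saturation `L` (degree `l ≥ 0`) leaves `deg(E/L) = −4 − l ≤ −4` and `deg 𝓗om(E/L, L) = 2l + 4 ≥ 4`. (γB) generically invertible on `2C`:
`d₁ + d' = −4`, `d₁ ≥ d' − 2`; a section forces `d₁ ≥ 0`, `d' ≤ −4`, `d₁ − d' ≥ 4`. [shadow: `omega`] -/
theorem pg10_curve_cases :
    (∀ da db l : ℤ, (da - 1) + (db - 1) - l = -6 → l ≤ 2 → da ≤ db → da + db = l - 4 ∧ da ≤ -1) ∧
    (∀ da e : ℤ, (e - 1) + (da - 1) = -6 →
        e = -4 - da ∧ (da ≤ -3 ↔ -1 ≤ e) ∧ (-2 ≤ da → e ≤ -2) ∧ (2 ≤ e ↔ da ≤ -6)) ∧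
    (∀ l : ℤ, 0 ≤ l → (-4 - l ≤ -4 ∧ 4 ≤ l - (-4 - l))) ∧
    (∀ d1 d' : ℤ, d1 + d' = -4 → d' - 2 ≤ d1 → (0 ≤ d1 ∨ 0 ≤ d') → 0 ≤ d1 ∧ d' ≤ -4 ∧ 4 ≤ d1 - d') := by
  refine ⟨fun da db l h1 h2 h3 => ⟨by omega, by omega⟩, fun da e h => ⟨by omega, by omega, by omega, by omega⟩,
    fun l hl => ⟨by omega, by omega⟩, fun d1 d' h1 h2 h3 => ?_⟩
  rcases h3 with h3 | h3 <;> exact ⟨by omega, by omega, by omega⟩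

/-- **R-JD-B1 closed ([XXIII] §6).** Minimal reading, B₁ side: a balanced sheaf of class `(0, 2θ, 2)` of type (B) on a double symmetric theta
divisor `2C` ([18] 3.6: quotient line bundle `Q'` of degree `d`, torsion of length `ℓ`, `2d + ℓ = 6`) has the kernel line bundle `G₁ =
ker(Q → Q')` of degree `4 − d`; after the twist by `Θ_{κ₁}` (degree `2` on `C`) the pieces have degrees `6 − d` and `d + 2`, and
`H¹(Q(Θ_{κ₁})) ≠ 0` needs `h¹ ≠ 0` on one of them, i.e. `6 − d ≤ 2` or `d + 2 ≤ 2` (genus 2; the boundary cases are included); the first is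
impossible (`ℓ ≥ 0`), so `d ≤ 0` and `deg 𝓗om(Q', G₁) = 4 − 2d ≥ 4 > 2g − 2`: a non-zero nilpotent endomorphism — the sheaf is not simple.
[shadow: `omega`] -/
theorem pg10_minimal_b1 (d l : ℤ) (h : 2 * d + l = 6) (hl : 0 ≤ l) (hjump : 6 - d ≤ 2 ∨ d + 2 ≤ 2) :
    d ≤ 0 ∧ 4 ≤ (4 - d) - d ∧ (4 - d) + d = 4 := by
  rcases hjump with hj | hj
  · exact absurd hl (by omega)
  · exact ⟨by omega, by omega, by omega⟩

/-- **The instance (1,2) ([XXIII] 3.4; [19] THEOREM K2 / [20] THEOREM R2's first residual).** Type II frame `λ_j = (1,1)` (`𝒪(Θ′)`),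
`λ_n = (1,0)` (`P_z`): `det = −1`; `u_j = (1,1,1)`, `u_n = (1,0,0)`, `n = (2,1,0)`, `w₂ = 6u_n + 2n = (10,2,0)`; the cohomological
`Φ(r,c,s) = (s,−c,r)` gives `Φ(w₂) = (0,−2,10)`, so `Q̂ = Φ¹(Q₂)` has class `(0, 2, −10)` and `Q̂ ⊗ 𝒪(Θ̂)` (`T(r,c,s) = (r, c+r, s+2c+r)`) class
`(0, 2, −6)`; `Φ(𝒪(Θ′)) = (1,−1,1) = 𝒪(−Θ̂″)`; `hom(Q₂, 𝒪(Θ′)) = h¹(Q̂(Θ̂″)) = 6 + h⁰ = 6 < 8 = 4 + 4`. [shadow: `decide`] -/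
theorem pg10_example_12 :
    ((1 : ℤ) * 0 - 1 * 1 = -1) ∧
    (((1 : ℤ) ^ 2, (1 : ℤ) * 1, (1 : ℤ) ^ 2) = (1, 1, 1)) ∧ (((1 : ℤ) ^ 2, (1 : ℤ) * 0, (0 : ℤ) ^ 2) = (1, 0, 0)) ∧
    ((2 * (1 : ℤ) * 1, (1 : ℤ) * 0 + 1 * 1, 2 * (1 : ℤ) * 0) = (2, 1, 0)) ∧
    ((6 * (1 : ℤ) + 2 * 2, 6 * (0 : ℤ) + 2 * 1, 6 * (0 : ℤ) + 2 * 0) = (10, 2, 0)) ∧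
    (((0 : ℤ), -(2 : ℤ), (10 : ℤ)) = (0, -2, 10)) ∧
    (((0 : ℤ), (2 : ℤ) + 0, (-10 : ℤ) + 2 * 2 + 0) = (0, 2, -6)) ∧
    (((1 : ℤ), -(1 : ℤ), (1 : ℤ)) = (1, -1, 1)) ∧
    ((6 : ℤ) + 0 < 4 + 4) := by
  decide

/-- **The box after THEOREM DBN ([XXIII] §5.3).** [XXII] 7.1's tally of the 443 bi-positive readings of height ≤ 40 — MINIMAL 1, VOID 1,
EMPTY 26, VOID-off-the-double-Brill–Noether-locus 415 — becomes VOID 417 / EMPTY 26 once the residual is empty; by type 132 + 311.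
[shadow: `decide`] -/
theorem pg10_counts :
    (1 + 1 + 26 + 415 = 443) ∧ (1 + 1 + 415 = 417) ∧ (417 + 26 = 443) ∧ (132 + 311 = 443) ∧ (291 + 124 = 415) := by
  decide

end ProductGroundTen

section ProductGroundTenAdd1

/-- **ADDENDUM 1 ([XXIII] §13.2): the type-I instance D(3,0) = (−5,4), B₁ side, and COROLLARY J's bookkeeping.** First frame `((3,−1),(1,0))`
(type I, `det = +1`): `u₀ = (9,−3,1) = S₀`, `u₁ = (1,0,0) = P_z`, `v = u₀ − 3u₁ = (6,−3,1)`, `n = (6,−1,0)`, `w₁ = 6u₁ + 2n = (18,−2,0)`. Dualised frame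
`(λ_j,λ_n) = ((3,1),(1,0))`: `det = −1`, `u_j = (9,3,1) = S₀^∨`, `u_n = (1,0,0)`, `n^∨ = (6,1,0)`, `w = w₁^∨ = (18,2,0) = 6u_n + 2n^∨`; pairings
`⟨u_n,u_j⟩ = −1`, `⟨u_n,w⟩ = 0`, `⟨u_j,w⟩ = −6`, `⟨w,w⟩ = 8`; the destabilising class `S_e = n^∨ − (e−1)u_n = (7−e, 1, 0)` with
`c₁(S)·rk w − c₁(w)·rk S = 18 − 2(7−e) = 2(e+2) = 2β_n²(e+2)` (`β_n = 1`), positive iff `e ≥ −1` (`e = −2`: equal slopes `2/9`); and the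
count `hom(S₀, Q₁) = 6 + h⁰ = 6 < 8`. COROLLARY J: with `Hom(V,Q) = 0` and `Ext¹(M,Q) = 0` the exact sequence gives `hom(R,Q) = 0 + 0`.
[shadow: `decide` / `omega`] -/
theorem pg10a_example_d30 :
    ((3 : ℤ) * 0 - 1 * (-1) = 1) ∧ ((3 : ℤ) * 0 - 1 * 1 = -1) ∧
    (((3 : ℤ) ^ 2, (3 : ℤ) * (-1), (-1 : ℤ) ^ 2) = (9, -3, 1)) ∧ (((9 : ℤ) - 3 * 1, (-3 : ℤ) - 3 * 0, (1 : ℤ) - 3 * 0) = (6, -3, 1)) ∧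
    ((2 * (3 : ℤ) * 1, (3 : ℤ) * 0 + 1 * (-1), 2 * (-1 : ℤ) * 0) = (6, -1, 0)) ∧
    ((6 * (1 : ℤ) + 2 * 6, 6 * (0 : ℤ) + 2 * (-1), 6 * (0 : ℤ) + 2 * 0) = (18, -2, 0)) ∧
    (((3 : ℤ) ^ 2, (3 : ℤ) * 1, (1 : ℤ) ^ 2) = (9, 3, 1)) ∧ ((2 * (3 : ℤ) * 1, (3 : ℤ) * 0 + 1 * 1, 2 * (1 : ℤ) * 0) = (6, 1, 0)) ∧
    ((6 * (1 : ℤ) + 2 * 6, 6 * (0 : ℤ) + 2 * 1, 6 * (0 : ℤ) + 2 * 0) = (18, 2, 0)) ∧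
    (let P : ℤ × ℤ × ℤ → ℤ × ℤ × ℤ → ℤ := fun u v => 2 * u.2.1 * v.2.1 - u.1 * v.2.2 - v.1 * u.2.2
     P (1,0,0) (9,3,1) = -1 ∧ P (1,0,0) (18,2,0) = 0 ∧ P (9,3,1) (18,2,0) = -6 ∧ P (18,2,0) (18,2,0) = 8) ∧
    (∀ e : ℤ, (1 : ℤ) * 18 - 2 * (7 - e) = 2 * (e + 2) ∧ (0 < 2 * (e + 2) ↔ -1 ≤ e)) ∧
    ((6 : ℤ) + 0 < 8) ∧ (∀ hV hM : ℕ, hV = 0 → hM = 0 → hV + hM = 0) := by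
  refine ⟨by decide, by decide, by decide, by decide, by decide, by decide, by decide, by decide, by decide, by decide, ?_, by decide, ?_⟩
  · intro e; exact ⟨by ring, by omega⟩
  · intro hV hM h1 h2; omega

end ProductGroundTenAdd1

end Summit.HodgeConjecture.HodgeConjecture.WeilTypeLadder
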